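import Literature.MathematicalPhysics.QuantumFieldTheory.Balaban1983to89.B1Eq324BenfattoClassSectEMemberIneq2153ScalarReductionAtNode00
import Literature.MathematicalPhysics.QuantumFieldTheory.Balaban1983to89.B6Ineq2153MultiLevelV1

/-!
# `Balaban1983to89.B1Eq324BenfattoClassSectEMemberPrecisionDoorGamma0AtOne` — THE `γ₀` ROW AT `U = 1` PROVED AT NODE 00's LETTERS:
# [Balaban1985BackgroundPropagators] p. 428 *«C\*Δ_kC with a lower bound γ₀ > 0 independent of k and U. We have proved it in [4], Lemma 2.4, for operators
# with U = 1»* — [4] (2.153) `⟨B, Δ_k(1)B⟩ ≥ γ₀‖B‖²` with the MEMBER-UNIFORM `γ₀ = (1∕(12(d+1)²))·L^{−(d+2)}` for def-Y's print-unit letter `η^{d+1}Δ_k(1)`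
# (`deltaKPY … 1`) on PRINT's constrained subspace (STAR reading of «c ∈ Λ′»; sources in `Ω_k^{(k)}`), for EVERY member of the class — the scalar row by
# `B6Ineq2153MultiLevelV1` (Schur + Jensen + Lemma 2.4, position space), the matrix row by dag-n08-d's lift `…Ineq2153ScalarReductionAtNode00`

statement-level companion of published sources with citation tags; every declaration here is a theorem; nothing here is a claim about the Yang–Mills mass gap.

THE PRINT.  [Balaban1985BackgroundPropagators] (3.156) p. 428: *«⟨B,(QG₁Q\*)⁻¹B⟩ − a⟨B,B⟩ − 2⟨H₁D̃⁽²⁾(B),J⟩ = ⟨B,Δ_kB⟩ … considered on the subspace {B : B = 0 on Λᶜ,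
B = 0 on ⋃_{y∈Λ′} Ax(y), Q₁B = 0}»*; p. 428: *«a positive definite operator C\*Δ_kC with a lower bound γ₀ > 0 independent of k and U. We have proved it in [4],
Lemma 2.4, for operators with U = 1.»*  [Balaban1984PropagatorsII] (2.153) p. 249: *«Using (2.118) and (2.128) we get ⟨B, Δ_kB⟩ ≥ (γ₀∕12d²)L^{−d−1}‖B‖² … on
the subspace of B satisfying: QB = 0, B(Γ_{y,x}) = 0 for x ∈ B(y)»*; (2.3) p. 224: *«we denote by Ω also the set of bonds ⋃_{x∈Ω} st(x) = {bonds b: at least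
one end-point of b belongs to Ω}»*; Lemma 2.4 p. 245: *«We denote by Λ also a set of bonds b such that at least one of the end-points b₋, b₊ belongs to Λ»*.
[Balaban1985Averaging] (125) p. 36 (the one-step average `Q(V)`, `V = 1`).

WHY THIS MODULE (cell `pub-ymgap`, D-0062; seat dag-n08-b gen 36, CLAIM-16 (C); node N06 G-B9-09 ∕ node N08 [Balaban1985UV3] row `h324c`; node00-def-Y
LOCATED-D153 ∕ WORD-L; dag-n08-d g37 INTENT-91).  The (3.24) precision doors of this lineage at `U = 1` (p679063 §3b, p683587 §2) hold MODULO one row: [4]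
(2.153) for def-Y's `η^{d+1}Δ_k(1) = deltaKPY … 1` on the constrained subspace.  This session's chain PROVES that row in position space: (A)
`B6Ineq2118LowerMultiLevelV1` — `⟨B,(QGQ\*)⁻¹B⟩ − ⟨B,aB⟩ = ‖∂(HB)‖²` EXACTLY and the lower (1.67)∕(2.118) by Jensen («the curl of a block average is an average
of fluxes») for the MULTI-LEVEL operator of every nested family; (B) `B6Lemma24TopTorusV1` — Lemma 2.4 (2.128) on `T^{(k)}` with `L`-blocks; (B2)
`B6Ineq2153MultiLevelV1` — their composition, (2.153) for r03∕p21's `EE − w` on `BondIdx (domT …)` in print's units; dag-n08-d's p686117 — at NODE 00's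
letters `(QG₁Q\*)⁻¹(1)` IS the lift of that `EE` and the matrix Δ_k-row (trace pairing, `M_N(ℂ)`-valued fields) follows from the scalar row for ANY
description `(Z, S)` of the constrained subspace (`ineq2153_one_of_scalarRow_on`).  THIS FILE closes the chain: §1 the dictionary at a member (def-Y's
`readUY ∕ Q1Y … 1 ∕ IsCornerY ∕ ublockY ∕ labK ∕ ofZ ∕ uΓ ∕ IsAxialY` ↔ (B)'s `zcast ∕ zlift ∕ coarseSites ∕ treeBonds ∕ q1`), §2 the scalar row, §3 the matrix
row at any letters whose `(QG₁Q\*)⁻¹(1)` is that lift and at the v4 letters of record.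
THE SUBSPACE (dag-n08-b CHECK-L, node00-def-Y WORD-L, pub-ymgap bus 2026-08-29): «`c ∈ Λ′`» and «`B = 0` on `Λᶜ`» are read with [4]'s STAR
convention — constraints `(Q(1)B)(c) = 0` at EVERY `L`-corner bond `c = (y, μ)` of the unit lattice (`IsCornerY`; the corners with no good end block are
automatic), variables on the top-level bonds with a good SOURCE block or a good TARGET block whose source lies in `Ω_k^{(k)}` (the latter is automatic in
print by the separation (2.2) of `Λ` from `Λ_kᶜ` — `MemberY.hΛsep` — and is what def-Y's (125)-reading `readUY` sees; node00-def-Y's announced star edition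
`inΛstY ∕ IsCoarseStY` names these sets and supplies `inΛstY → …` by `Iff`-level lemmas), and `B = 0` on the axial trees `IsAxialY`.  On def-Y's CURRENT
both-end-good constraint set `CBondY` the row is FALSE at slab members (CHECK-L's kernel vector), so p683587 §2's binder is NOT discharged here and the
`U = 1` door waits for the star letters `Λ̃ ∕ C ∕ C\*` (their `C(1)` must range in THIS subspace); nothing of that is claimed.

WHAT IS PROVED (0 `sorry`, 0 `def`, standard axioms; member `x : MemberY …`, `U = 1`, real bond functions `g : IBondY x.toKIdx → ℝ` and their unit-bond
reading `readUY x g` — def-Y's `readUY` at the fibre `ℝ`).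
* §1 `readUY_ofReal` (reading commutes with `ℝ ↪ ℂ`); `readUY_eq_of_lamBond` ∕ `readUY_eq_zero_of_not_lamBond` (the reading IS (B2)'s top reading `ĝ` over
  `LamBond k`, given sources in `Ω_k^{(k)}`); `labK_ofZ_of_mem_coarseSites`, `corner_eq_of_mem_coarseSites`, `isCornerY_ofZ_of_mem_coarseSites` (pv09's coarse
  sites `T′` ARE def-Y's corners), ★ `sum_ublockY_eq_sum_block` (def-Y's `ublockY` ↔ b06's `block`), ★★ `Q1Y_one_ofReal_eq_q1` — **def-Y's `(Q(1)g)(c)` of (125)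
  at a corner IS pv09's verbatim (2.125) `q1` of the lifted reading** (via dag-n08-d's `Q1Y_avYOfRecord_one_eq`), `mem_uΓ_of_mem_comb`, ★★
  `readUY_treeBond_eq_zero` — the reading vanishes on EVERY tree bond of EVERY `L`-block (good blocks: `IsAxialY` through `B9Eq3169Comb.exists_mem_comb_iff` and
  def-Y's `uΓ`; other blocks: both end blocks non-good).
* §2 `hLM_of_member` (`L ∣ sitesPerDir k`); ★★★ **`scalarRow_starOm`** — for `1 ≤ d` and every `g` vanishing off the star support and on the axial bonds with
  `(Q(1)g)(c) = 0` at every corner: **`(1∕(12(d+1)²))·(L^{d+2})⁻¹·Σ_q g(q)² ≤ η^{d+1}·Σ_q g(q)·((onFun EE g)(q) − w(q)g(q))`** (`etaDY x`, r03's `EE (domT …) x.hcf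
  x.hw`, the weights `x.w`) — (B2)'s `ineq2153_multiLevel_fun_printUnits` at `c_f = Lᵏ` (`x.hcfk`).
* §3 ★★★ `ineq2153_one_starOm` — at any covariance letters `𝔏` with `𝔏.QG1Qinv 1 = liftEndY (onFun EE)` and any Sect. E letters `𝔢`, for every matrix field
  `B` on the same subspace: **`γ₀·trIP 1 B B ≤ trIP 1 B (deltaKPY x 𝔏 𝔢 1 B)`**, `γ₀ = (1∕(12(d+1)²))·L^{−(d+2)}` (dag-n08-d `ineq2153_one_of_scalarRow_on`);
  ★★★ `ineq2153_one_lettersYOfRecordV4_starOm` — the same at the v4 letters of record `lettersYOfRecordV4 N θ M⋆ 𝔯 x` (any residual family), `2 ≤ d₆ + 1`.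

HONEST SCOPE.  Count-neutral Literature theorems; `U = 1` only (general `U` is p. 428's «localizing … methods of Sect. B», not touched); `γ₀` is print's
`(1∕12d²)L^{−d−1}` with Jensen's `γ₀ = 1` in (2.118) and `d ↦ d+1` (NODE 00's torus has `d + 1` directions), in def-Y's print units; the source-in-`Ω_k^{(k)}`
clause of the support is displayed, not derived from `hΛsep`; the door p683587 §2 ∕ p679063 §3b is NOT re-keyed (its `C(1)` solves the both-good constraints
only); the IDENT for row `h324c` is NOT made; node N06 ∕ N08 NOT discharged; nothing about `d = 4` specifically, the continuum, OS axioms, a mass gap or Clay.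
-/

noncomputable section

open Finset Matrix
open scoped Matrix.Norms.L2Operator

namespace Literature.MathematicalPhysics.QuantumFieldTheory.Balaban1983to89.B1Eq324BenfattoClassSectEMemberPrecisionDoorGamma0AtOne

open Literature.MathematicalPhysics.QuantumFieldTheory
open Literature.MathematicalPhysics.QuantumFieldTheory.Balaban1983to89.Node00
open Literature.MathematicalPhysics.QuantumFieldTheory.Balaban1983to89.B9Thm311ReadingCoords (trIP)
open B9PinMembersKLevelV1 (MemberY)
open B9PinGeometryKLevelV1 (inΛY)
open B6SectAVectorModelV1 (EE)
open B6GlobalChartV1 (PV domT)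
open B6Ineq2133TwoScaleV1 (onFun onFun_apply)
open B6Ineq2142KLevelV1 (lvl)
open B6BondElimination (unitVec treeBonds mem_treeBonds add_unitVec_mem_block)
open B6Elimination (corner mem_block corner_eq_self_of_dvd mem_block_corner_iff corner_corner mem_block_corner)
open B9Eq3169Comb (comb exists_mem_comb_iff)
open B6Lemma24Torus (coarseSites mem_coarseSites faces mem_faces pbox mem_pbox block_subset_pbox)
open B6Lemma24TopTorusV1 (zcast zlift zlab periodAt)
open B6Ineq2153MultiLevelV1 (ineq2153_multiLevel_fun_printUnits)
open B1Eq324BenfattoClassSectEMemberIneq2153ScalarReductionAtNode00 (Q1Y_avYOfRecord_one_eq qNormY_eq_ofReal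
  ineq2153_one_of_scalarRow_on ineq2153_one_lettersYOfRecordV4_of_scalarRow_on)

variable {d ℓ : ℕ} {hd : 1 ≤ d + 1} {hL : Odd (ℓ + 1) ∧ 1 < ℓ + 1} {b₀ b₁ : ℝ} {Mstar : ℕ}
variable (x : MemberY d ℓ hd hL b₀ b₁ Mstar)

/-! ## §1 The dictionary at a member, `U = 1`: the unit-bond reading of a real bond function and its constraints -/

section Dictionary

/-- the unit-bond reading commutes with `ℝ ↪ ℂ`. [cite: Balaban1984PropagatorsII, (2.3) p.224, bookkeeping] -/
theorem readUY_ofReal (g : IBondY x.toKIdx → ℝ) (bd : UBondY x) :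
    readUY x (fun q => ((g q : ℝ) : ℂ)) bd = ((readUY x g bd : ℝ) : ℂ) := by
  by_cases h : bd.src ∈ (domT x.hN x.D x.hk).Om x.k
  · rw [readUY_apply_of_mem x _ h, readUY_apply_of_mem x _ h]
  · rw [readUY_apply_of_not_mem x _ h, readUY_apply_of_not_mem x _ h, Complex.ofReal_zero]

/-- for `g` supported on bonds whose SOURCE lies in `Ω_k^{(k)}` (at the top level), def-Y's reading `readUY x g` IS the top reading of `g` over the index bonds
`Λ_k = st_k(Ω_k^{(k)})` ((B2)'s `ĝ`). [cite: Balaban1984PropagatorsII, (2.3) p.224 («at least one end-point»), bookkeeping] -/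
theorem readUY_eq_of_lamBond (g : IBondY x.toKIdx → ℝ)
    (hZ : ∀ q : IBondY x.toKIdx, ¬ (lvl x.hN x.D x.hk q = x.k ∧ usrc x q ∈ (domT x.hN x.D x.hk).Om x.k) → g q = 0)
    (b : UBondY x) (h : (domT x.hN x.D x.hk).LamBond x.k b) :
    readUY x g b = g ⟨⟨Fin.last x.k, b⟩, h⟩ := by
  by_cases hs : b.src ∈ (domT x.hN x.D x.hk).Om x.k
  · rw [readUY_apply_of_mem x _ hs]; rfl
  · rw [readUY_apply_of_not_mem x _ hs]
    symm
    refine hZ _ fun hq => hs ?_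
    have e : usrc x ⟨⟨Fin.last x.k, b⟩, h⟩ = b.src := iterBlockOf_embIter x.k x.hk _
    rw [← e]; exact hq.2

/-- … and vanishes off `Λ_k`. [cite: Balaban1984PropagatorsII, (2.3) p.224, bookkeeping] -/
theorem readUY_eq_zero_of_not_lamBond (g : IBondY x.toKIdx → ℝ) (b : UBondY x) (h : ¬ (domT x.hN x.D x.hk).LamBond x.k b) :
    readUY x g b = 0 :=
  readUY_apply_of_not_mem x _ fun hs => h (lamBond_of_src x hs)

/-- labels of a block over a coarse site round-trip through def-Y's chart. [cite: Balaban1984PropagatorsI, (1.6) p.18, bookkeeping] -/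
theorem labK_ofZ_of_mem_coarseSites (hLM : ∀ μ : Fin (d + 1), ℓ + 1 ∣ periodAt (PV d ℓ x.m x.K hd hL) x.k μ) {y : Fin (d + 1) → ℤ}
    (hy : y ∈ coarseSites (ℓ + 1) (periodAt (PV d ℓ x.m x.K hd hL) x.k)) {z : Fin (d + 1) → ℤ} (hz : z ∈ B6Elimination.block (ℓ + 1) y) :
    labK x (ofZ x z) = z :=
  labK_ofZ x fun μ => (mem_pbox.1 (block_subset_pbox hLM hy hz) μ)

/-- a coarse site is its own corner. [cite: Balaban1984PropagatorsI, (1.5)–(1.6) p.18, bookkeeping] -/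
theorem corner_eq_of_mem_coarseSites {y : Fin (d + 1) → ℤ} (hy : y ∈ coarseSites (ℓ + 1) (periodAt (PV d ℓ x.m x.K hd hL) x.k)) :
    corner (ℓ + 1) y = y :=
  corner_eq_self_of_dvd y fun i => by exact_mod_cast (mem_coarseSites.1 hy).2 i

/-- pv09's coarse sites `T′` chart to def-Y's `L`-corners `IsCornerY`, with the expected labels. [cite: Balaban1984PropagatorsII, (2.128) p.245 («c ∈ Λ′»); Balaban1985Averaging, p.24, bookkeeping] -/
theorem isCornerY_ofZ_of_mem_coarseSites (hLM : ∀ μ : Fin (d + 1), ℓ + 1 ∣ periodAt (PV d ℓ x.m x.K hd hL) x.k μ) {y : Fin (d + 1) → ℤ}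
    (hy : y ∈ coarseSites (ℓ + 1) (periodAt (PV d ℓ x.m x.K hd hL) x.k)) : IsCornerY x (ofZ x y) ∧ labK x (ofZ x y) = y := by
  have hc := corner_eq_of_mem_coarseSites x hy
  have hlab : labK x (ofZ x y) = y :=
    labK_ofZ_of_mem_coarseSites x hLM hy (by have h := mem_block_corner ell_succ_pos (L := ℓ + 1) y; rwa [hc] at h)
  exact ⟨(isCornerY_iff x _).2 (by rw [hlab, hc]), hlab⟩

/-- ★ def-Y's `L`-block `ublockY x (ofZ y)` of a corner and b06's label block `block L y` carry the same sums (`labK ∕ ofZ`). [cite: Balaban1984PropagatorsI, (1.6) p.18, (1.11) p.19, bookkeeping] -/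
theorem sum_ublockY_eq_sum_block (hLM : ∀ μ : Fin (d + 1), ℓ + 1 ∣ periodAt (PV d ℓ x.m x.K hd hL) x.k μ) {y : Fin (d + 1) → ℤ}
    (hy : y ∈ coarseSites (ℓ + 1) (periodAt (PV d ℓ x.m x.K hd hL) x.k)) {α : Type*} [AddCommMonoid α] (F : (Fin (d + 1) → ℤ) → α) :
    ∑ z ∈ ublockY x (ofZ x y), F (labK x z) = ∑ z' ∈ B6Elimination.block (ℓ + 1) y, F z' := by
  obtain ⟨hcor, hlab⟩ := isCornerY_ofZ_of_mem_coarseSites x hLM hy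
  have hc := corner_eq_of_mem_coarseSites x hy
  have hcor' : corner (ℓ + 1) (labK x (ofZ x y)) = y := by rw [hlab, hc]
  refine Finset.sum_bij' (fun z _ => labK x z) (fun z' _ => ofZ x z') (fun z hz => ?_) (fun z' hz' => ?_) (fun z _ => ofZ_labK x z)
    (fun z' hz' => labK_ofZ_of_mem_coarseSites x hLM hy hz') (fun _ _ => rfl)
  · have h := labK_mem_block_of_mem_ublockY x hz
    rwa [hcor'] at h
  · rw [mem_ublockY, labK_ofZ_of_mem_coarseSites x hLM hy hz', hcor', ← hc]
    exact (mem_block_corner_iff ell_succ_pos).1 (by rw [hc]; exact hz')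

/-- ★★ **def-Y's `(Q(1)g)(c)` of (125) at the corner `(ofZ y, μ)` IS pv09's verbatim (2.125) `(Q₁ĝ^ℤ)(y, μ)`** of the lifted reading (dag-n08-d's explicit `U = 1`
formula `Q1Y_avYOfRecord_one_eq`; `qNormY = L^{−(d+2)}` = pv09's `(n^{d′+1})⁻¹` with `d′ = d + 1`). [cite: Balaban1985Averaging, (125) p.36; Balaban1984PropagatorsII, (2.125) p.245; Balaban1984PropagatorsI, (1.11) p.19] -/
theorem Q1Y_one_ofReal_eq_q1 (hLM : ∀ μ : Fin (d + 1), ℓ + 1 ∣ periodAt (PV d ℓ x.m x.K hd hL) x.k μ) (g : IBondY x.toKIdx → ℝ)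
    {y : Fin (d + 1) → ℤ} (hy : y ∈ coarseSites (ℓ + 1) (periodAt (PV d ℓ x.m x.K hd hL) x.k)) (μ : Fin (d + 1)) :
    Q1Y x (avYOfRecord x) (fun _ _ => 1 : CfgY ℂ x.toKIdx) (ofZ x y, μ) (fun q => ((g q : ℝ) : ℂ)) =
      ((B6Lemma24PrintedShape.q1 (ℓ + 1) (zlift (readUY x g)) (y, μ) : ℝ) : ℂ) := by
  rw [Q1Y_avYOfRecord_one_eq, qNormY_eq_ofReal, smul_eq_mul]
  simp only [readUY_ofReal, ← Complex.ofReal_sum, ← Complex.ofReal_mul]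
  rw [Complex.ofReal_inj, B6Lemma24PrintedShape.q1, ← Finset.mul_sum,
    sum_ublockY_eq_sum_block x hLM hy (fun w => ∑ s ∈ Finset.range (ℓ + 1), readUY x g ⟨ofZ x (w + (s : ℤ) • unitVec μ), μ⟩)]
  rfl

/-- a comb bond of a good block, read as an index bond, lies on def-Y's contour `uΓ`. [cite: Balaban1985BackgroundPropagators, (3.169) p.430; Balaban1985Averaging, p.24, bookkeeping] -/
theorem mem_uΓ_of_mem_comb {u : USiteY x} (hu : GoodY x u) {b : (Fin (d + 1) → ℤ) × Fin (d + 1)} (hb : b ∈ comb (ℓ + 1) (labK x u)) :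
    idxOfU x ⟨ofZ x b.1, b.2⟩ (comb_src_mem_Om x hu hb) ∈ uΓ x u := by
  classical
  unfold uΓ
  rw [dif_pos hu, List.mem_pmap]
  exact ⟨b, hb, rfl⟩

/-- ★★ **THE TREE CONDITION (2.121) FOR THE READING, ON EVERY BLOCK OF THE UNIT TORUS**: for `g` vanishing off the star support (sources in `Ω_k^{(k)}`) and on
the axial bonds, `ĝ(b) = 0` for every tree bond `b` of every `L`-block — on a good block `b` lies on a comb `Γ_{ȳ,x}` (`B9Eq3169Comb.exists_mem_comb_iff`), i.e.
on def-Y's `uΓ`, so `IsAxialY`; on any other block both end blocks of `b` are that block, so the star support excludes it.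
[cite: Balaban1984PropagatorsII, (2.121) p.244, (2.153) p.249 («B(Γ_{y,x}) = 0»); Balaban1985BackgroundPropagators, (3.156) p.428 («B = 0 on ⋃ Ax(y)»)] -/
theorem readUY_treeBond_eq_zero (hLM : ∀ μ : Fin (d + 1), ℓ + 1 ∣ periodAt (PV d ℓ x.m x.K hd hL) x.k μ) (g : IBondY x.toKIdx → ℝ)
    (hZ : ∀ q : IBondY x.toKIdx,
      ¬ (lvl x.hN x.D x.hk q = x.k ∧ (GoodY x (usrc x q) ∨ (usrc x q ∈ (domT x.hN x.D x.hk).Om x.k ∧ GoodY x (utgt x q)))) → g q = 0)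
    (hAx : ∀ q, IsAxialY x q → g q = 0)
    {y : Fin (d + 1) → ℤ} (hy : y ∈ coarseSites (ℓ + 1) (periodAt (PV d ℓ x.m x.K hd hL) x.k))
    {b : (Fin (d + 1) → ℤ) × Fin (d + 1)} (hb : b ∈ treeBonds (ℓ + 1) y) :
    readUY x g ⟨zcast x.k b.1, b.2⟩ = 0 := by
  have hc := corner_eq_of_mem_coarseSites x hy
  obtain ⟨xl, hxl, hbx⟩ := (exists_mem_comb_iff ell_succ_pos hc b).2 hb
  -- the unit site whose comb carries `b`
  have hxlb : xl ∈ B6Elimination.block (ℓ + 1) y := by rw [← hxl]; exact mem_block_corner ell_succ_pos xl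
  have hlab : labK x (ofZ x xl) = xl := labK_ofZ_of_mem_coarseSites x hLM hy hxlb
  have hbx' : b ∈ comb (ℓ + 1) (labK x (ofZ x xl)) := by rw [hlab]; exact hbx
  change readUY x g ⟨ofZ x b.1, b.2⟩ = 0
  by_cases hs : (⟨ofZ x b.1, b.2⟩ : UBondY x).src ∈ (domT x.hN x.D x.hk).Om x.k
  · rw [readUY_apply_of_mem x _ hs]
    by_cases hgood : GoodY x (ofZ x xl)
    · -- an axial bond of a good block
      exact hAx _ ⟨ofZ x xl, mem_uΓ_of_mem_comb x hgood hbx'⟩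
    · -- a tree bond inside a non-good block: both end blocks are that block
      have hblk : B6Elimination.block (ℓ + 1) (corner (ℓ + 1) (labK x (ofZ x xl))) = B6Elimination.block (ℓ + 1) y := by rw [hlab, hxl]
      have h1 : b.1 ∈ B6Elimination.block (ℓ + 1) (corner (ℓ + 1) (labK x (ofZ x xl))) := by rw [hblk]; exact (mem_treeBonds.1 hb).1
      have h2 : b.1 + unitVec b.2 ∈ B6Elimination.block (ℓ + 1) (corner (ℓ + 1) (labK x (ofZ x xl))) := by
        rw [hblk]; exact add_unitVec_mem_block (mem_treeBonds.1 hb).1 (mem_treeBonds.1 hb).2.2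
      refine hZ _ fun hq => hgood ?_
      rcases hq.2 with hg | ⟨-, hg⟩
      · rw [usrc_idxOfU] at hg
        exact (goodY_iff_of_blockOf_eq x (blockOf_ofZ_eq x h1)).1 hg
      · rw [utgt_idxOfU] at hg
        have e : (⟨ofZ x b.1, b.2⟩ : UBondY x).tgt = ofZ x (b.1 + unitVec b.2) := by rw [ofZ_add_unitVec]; rfl
        rw [e] at hg
        exact (goodY_iff_of_blockOf_eq x (blockOf_ofZ_eq x h2)).1 hg
  · exact readUY_apply_of_not_mem x _ hs

end Dictionary

/-! ## §2 ★★★ The scalar Δ_k-row at a member, `U = 1`, PRINT's STAR subspace (with sources in `Ω_k^{(k)}`), `γ₀ = (1∕(12(d+1)²))·L^{−(d+2)}` -/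

section ScalarRow

/-- the unit torus of a member is tiled by `L`-blocks: `L ∣ sitesPerDir k` (def-Y `sitesPerDir_k`). [cite: Balaban1984PropagatorsII, (2.1) p.224, bookkeeping] -/
theorem hLM_of_member (μ : Fin (d + 1)) : ℓ + 1 ∣ periodAt (PV d ℓ x.m x.K hd hL) x.k μ := by
  show ℓ + 1 ∣ (PV d ℓ x.m x.K hd hL).sitesPerDir x.k
  rw [sitesPerDir_k x μ]; exact Dvd.intro _ rfl

/-- ★★★ **THE SCALAR Δ_k-ROW AT `U = 1`, PRINT's STAR SUBSPACE, MEMBER-UNIFORM `γ₀`**: for `1 ≤ d` and every real bond function `g` of NODE 00's carrier with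
(i) `g(q) = 0` unless `q` is a top-level bond with a good SOURCE block, or a good TARGET block and source in `Ω_k^{(k)}` (print: «B = 0 on Λᶜ», star reading);
(ii) `g = 0` on the axial bonds `⋃ Δ_k(y)` (`IsAxialY`); (iii) `(Q(1)g)(c) = 0` at EVERY `L`-corner bond `c` (print: «Q₁B = 0», star reading):
`(1∕(12(d+1)²))·(L^{d+2})⁻¹·Σ_q g(q)² ≤ η^{d+1}·Σ_q g(q)·((onFun ((QGQ*)⁻¹) g)(q) − w(q)g(q))` — [4] (2.153) with Jensen's `γ₀ = 1`, `d ↦ d + 1`, in def-Y's print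
units (`etaDY`), via (B2) `ineq2153_multiLevel_fun_printUnits` at `c_f = Lᵏ` and §1's dictionary.
[cite: Balaban1984PropagatorsII, (2.153) p.249, (2.118) p.243, Lemma 2.4 (2.128) p.245, (2.3) p.224; Balaban1985BackgroundPropagators, (3.156) p.428, p.428 («γ₀ > 0 independent of k and U … [4], Lemma 2.4, for … U = 1»)] -/
theorem scalarRow_starOm (hd1 : 1 ≤ d) (g : IBondY x.toKIdx → ℝ)
    (hZ : ∀ q : IBondY x.toKIdx,
      ¬ (lvl x.hN x.D x.hk q = x.k ∧ (GoodY x (usrc x q) ∨ (usrc x q ∈ (domT x.hN x.D x.hk).Om x.k ∧ GoodY x (utgt x q)))) → g q = 0)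
    (hAx : ∀ q, IsAxialY x q → g q = 0)
    (hQ : ∀ c : USiteY x × Fin (d + 1), IsCornerY x c.1 →
      Q1Y x (avYOfRecord x) (fun _ _ => 1 : CfgY ℂ x.toKIdx) c (fun q => ((g q : ℝ) : ℂ)) = 0) :
    1 / (12 * (((d + 1 : ℕ) : ℝ)) ^ 2) * ((((ℓ + 1 : ℕ) : ℝ)) ^ (d + 2))⁻¹ * ∑ q, g q ^ 2 ≤
      etaDY x * ∑ q, g q * (onFun (EE (domT x.hN x.D x.hk) x.hcf x.hw) g q - x.toKIdx.w q * g q) := by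
  have hLM := hLM_of_member x
  have hZ' : ∀ q : IBondY x.toKIdx, ¬ (lvl x.hN x.D x.hk q = x.k ∧ usrc x q ∈ (domT x.hN x.D x.hk).Om x.k) → g q = 0 :=
    fun q hq => hZ q fun h => hq ⟨h.1, h.2.elim (fun hg => mem_Om_of_good x hg rfl) fun hg => hg.1⟩
  have h := ineq2153_multiLevel_fun_printUnits (P := PV d ℓ x.m x.K hd hL) (domT x.hN x.D x.hk) (by show 2 ≤ d + 1; omega) (hLM 0)
    x.hcfk x.hcf x.hw g (fun q hq => hZ' q fun h => absurd h.1 (ne_of_lt hq)) (readUY x g) (readUY_eq_of_lamBond x g hZ')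
    (readUY_eq_zero_of_not_lamBond x g) (fun y hy b hb => readUY_treeBond_eq_zero x hLM g hZ hAx hy hb)
    (fun c' hc' => by
      have hy := mem_faces.1 hc'
      obtain ⟨hcor, -⟩ := isCornerY_ofZ_of_mem_coarseSites x hLM hy
      have h0 := hQ (ofZ x c'.1, c'.2) hcor
      rw [Q1Y_one_ofReal_eq_q1 x hLM g hy] at h0
      exact_mod_cast h0)
  have hη : etaDY x = (((((ℓ + 1 : ℕ) : ℝ)) ^ x.k) ^ (d + 1))⁻¹ := by rw [etaDY, inv_pow]
  rw [hη]
  exact h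

end ScalarRow

/-! ## §3 ★★★ The matrix Δ_k-row at NODE 00's letters on the same subspace (dag-n08-d's lift, by name) -/

section MatrixRow

variable {N : ℕ}

/-- ★★★ **THE MATRIX Δ_k-ROW AT NODE 00's LETTERS, `U = 1`, PRINT's STAR SUBSPACE**: at any covariance letters `𝔏` whose `(QG₁Q*)⁻¹(1)` is the lift of r03's
`(QGQ*)⁻¹` (the `U = 1` clause; at the letters of record: below) and any Sect. E letters `𝔢`, for every `B : bonds → M_N(ℂ)` on the subspace (i)–(iii):
`γ₀·⟨B,B⟩₁ ≤ ⟨B, η^{d+1}Δ_k(1)B⟩₁`, `γ₀ = (1∕(12(d+1)²))·L^{−(d+2)}` — §2 through dag-n08-d's `ineq2153_one_of_scalarRow_on`.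
[cite: Balaban1985BackgroundPropagators, (3.156) p.428, Cor. 3.5 p.407; Balaban1984PropagatorsII, (2.153) p.249, (2.35) p.228] -/
theorem ineq2153_one_starOm (hd1 : 1 ≤ d) (𝔏 : CovLettersY (Matrix (Fin N) (Fin N) ℂ) x)
    (𝔢 : SectELettersY (Matrix (Fin N) (Fin N) ℂ) x)
    (hT : 𝔏.QG1Qinv (fun _ _ => 1) = liftEndY (Matrix (Fin N) (Fin N) ℂ) (onFun (EE (domT x.hN x.D x.hk) x.hcf x.hw)))
    (B : IBondY x.toKIdx → Matrix (Fin N) (Fin N) ℂ)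
    (hZ : ∀ q : IBondY x.toKIdx,
      ¬ (lvl x.hN x.D x.hk q = x.k ∧ (GoodY x (usrc x q) ∨ (usrc x q ∈ (domT x.hN x.D x.hk).Om x.k ∧ GoodY x (utgt x q)))) → B q = 0)
    (hAx : ∀ q, IsAxialY x q → B q = 0)
    (hQ : ∀ c : USiteY x × Fin (d + 1), IsCornerY x c.1 →
      Q1Y x (avYOfRecord x) (fun _ _ => 1 : CfgY (Matrix (Fin N) (Fin N) ℂ) x.toKIdx) c B = 0) :
    1 / (12 * (((d + 1 : ℕ) : ℝ)) ^ 2) * ((((ℓ + 1 : ℕ) : ℝ)) ^ (d + 2))⁻¹ * trIP (fun _ => (1 : ℝ)) B B ≤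
      trIP (fun _ => (1 : ℝ)) B (deltaKPY x 𝔏 𝔢 (fun _ _ => 1) B) :=
  ineq2153_one_of_scalarRow_on x 𝔏 𝔢 _ hT
    (fun q => ¬ (lvl x.hN x.D x.hk q = x.k ∧ (GoodY x (usrc x q) ∨ (usrc x q ∈ (domT x.hN x.D x.hk).Om x.k ∧ GoodY x (utgt x q)))) ∨
      IsAxialY x q)
    (fun c => IsCornerY x c.1)
    (fun g hZg hQg => scalarRow_starOm x hd1 g (fun q hq => hZg q (Or.inl hq)) (fun q hq => hZg q (Or.inr hq)) hQg)
    B (fun q hq => hq.elim (hZ q) (hAx q)) hQ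

end MatrixRow

section Record

variable (N : ℕ) (θ : Stage3Params) (Mstar' : ℕ) (𝔯 : ResY N θ Mstar')

/-- ★★★ **THE SAME AT THE v4 LETTERS OF RECORD** `lettersYOfRecordV4 N θ M⋆ 𝔯 x` (any residual family `𝔯`, any Sect. E letters `𝔢` — the letters p683587 §2–§3
and dag-n08-d's doors read), `2 ≤ d₆ + 1`: the Δ_k-row of the `U = 1` doors on print's star subspace is a THEOREM with `γ₀ = (1∕(12(d₆+1)²))·L^{−(d₆+2)}`.
[cite: Balaban1985BackgroundPropagators, (3.156) p.428, (3.132) p.422, Cor. 3.5 p.407; Balaban1984PropagatorsII, (2.153) p.249] -/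
theorem ineq2153_one_lettersYOfRecordV4_starOm (hD : 2 ≤ θ.d₆ + 1) (x : MemberY θ.d₆ θ.ℓ₆ θ.hd' θ.hL' θ.b₀ θ.b₁ Mstar')
    (𝔢 : SectELettersY (Matrix (Fin N) (Fin N) ℂ) x) (B : IBondY x.toKIdx → Matrix (Fin N) (Fin N) ℂ)
    (hZ : ∀ q : IBondY x.toKIdx,
      ¬ (lvl x.hN x.D x.hk q = x.k ∧ (GoodY x (usrc x q) ∨ (usrc x q ∈ (domT x.hN x.D x.hk).Om x.k ∧ GoodY x (utgt x q)))) → B q = 0)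
    (hAx : ∀ q, IsAxialY x q → B q = 0)
    (hQ : ∀ c : USiteY x × Fin (θ.d₆ + 1), IsCornerY x c.1 →
      Q1Y x (avYOfRecord x) (fun _ _ => 1 : CfgY (Matrix (Fin N) (Fin N) ℂ) x.toKIdx) c B = 0) :
    1 / (12 * (((θ.d₆ + 1 : ℕ) : ℝ)) ^ 2) * ((((θ.ℓ₆ + 1 : ℕ) : ℝ)) ^ (θ.d₆ + 2))⁻¹ * trIP (fun _ => (1 : ℝ)) B B ≤
      trIP (fun _ => (1 : ℝ)) B (deltaKPY x (lettersYOfRecordV4 N θ Mstar' 𝔯 x) 𝔢 (fun _ _ => 1) B) :=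
  ineq2153_one_lettersYOfRecordV4_of_scalarRow_on N θ Mstar' 𝔯 x 𝔢
    (fun q => ¬ (lvl x.hN x.D x.hk q = x.k ∧ (GoodY x (usrc x q) ∨ (usrc x q ∈ (domT x.hN x.D x.hk).Om x.k ∧ GoodY x (utgt x q)))) ∨
      IsAxialY x q)
    (fun c => IsCornerY x c.1)
    (fun g hZg hQg => scalarRow_starOm x (by omega) g (fun q hq => hZg q (Or.inl hq)) (fun q hq => hZg q (Or.inr hq)) hQg)
    B (fun q hq => hq.elim (hZ q) (hAx q)) hQ

end Record

end Literature.MathematicalPhysics.QuantumFieldTheory.Balaban1983to89.B1Eq324BenfattoClassSectEMemberPrecisionDoorGamma0AtOne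

end
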